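import Literature.AlgebraicGeometry.Motives.AbelianVarietyFrobeniusGroupIdempotentRelations
import HarnessLib

/-!
# BRAUER RELATIONS give ISOGENY RELATIONS (Kani–Rosen's Theorem 3): if `⊕_i ℚ[G/H_i] ≅ ⊕_j ℚ[G/H'_j]` — i.e. for
# every `g` the fixed-point counts agree, `Σ_i |{x : x⁻¹gx ∈ H_i}|/|H_i| = Σ_j |{x : x⁻¹gx ∈ H'_j}|/|H'_j|` — then
# `∏_i B_{H_i} ∼ ∏_j B_{H'_j}`; GASSMANN EQUIVALENT subgroups (`|C ∩ H₁| = |C ∩ H₂|` for every conjugacy class `C`)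
# have isogenous images `B_{H₁} ∼ B_{H₂}` (Prasad–Rajan / Sunada) — ALGEBRAIC carrier, over an arbitrary (resp.
# perfect) field

Layer A1/A2 of the Hodge foundations lane (`lit-hodgefound`, row A1-20⁺ · A2, seat p03 generation 25, row g25-#3) on
the ALGEBRAIC carrier `AbelianVariety K` of `Motives/AbelianVariety` — Hom counts over an ARBITRARY field, isogenies
and dimensions over a PERFECT field.  Sequel of `Motives/AbelianVarietyFrobeniusGroupIdempotentRelations` §2 (the class
function `g ↦ χ_B(ρ(g)) = tr_ℤ(ρ(g) ∘ − | Hom(X, B))`: `trace_leftComp_map_conj`, `trace_leftComp_map_one`,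
**`mul_finrank_hom_image_eq_sum`** — `|H| · rk Hom(B_H, B) = Σ_{h ∈ H} χ_B(ρ h)`, "the multiplicity of the trivial
representation of `H`, by Frobenius reciprocity" — CONSUMED by name), of `Motives/AbelianVarietyIdempotentRelations`
(`norm_comp_norm_eq_card_nsmul`, `normG_comp_normG_eq_card_nsmul`) and of `Motives/AbelianVarietyIsogenyCancellation`
(the Hom-count criterion `isIsogenous_iff_forall_finrank_hom_eq'`, `finrank_hom_biprod`, `finrank_hom_biproduct(_const)`).
Kani–Rosen's Theorem B (`Motives/AbelianVarietyIdempotentRelations` §4) and all its instances in the sibling files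
evaluate ONE LITERAL relation `Σ_i |H_i| ε_{H_i} = (t − 1) + |G| ε_G` of `ℚ[G]`; the present file proves the general
principle behind every such computation: ANY relation that holds after evaluation by all class functions — i.e. any
relation between the permutation characters `1_{H}^G`, a BRAUER RELATION — yields the corresponding isogeny relation
among the `B_H = ε_H(X)`.  Everything is PROVED; the file introduces NO definition and NO named fact (net Literature
debt 0).

## Sources, verbatim

V. Dokchitser, H. Green, A. Konstantinou, A. Morgan, *Parity of ranks of Jacobians of curves*, Proc. London Math.
Soc. (2025), arXiv 2211.06357 (held text `paper:arxiv-2211.06357`), §1.3 p0004: "Recall that a Brauer relation in a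
finite group `G` is a formal linear combination of subgroups (up to conjugacy) `Σ_i H_i − Σ_j H_j'`, such that the
associated permutation representations `⊕_i ℂ[G/H_i]` and `⊕_j ℂ[G/H_j']` are isomorphic. Each Brauer relation gives
rise to an isogeny between Jacobians: **Theorem 1.3** ([Kani–Rosen] Theorem 3; see also Corollary 3.3). Let `X` be a
curve over a field `K` of characteristic `0` and let `G` be a finite group of `K`-automorphisms of `X`. For every Brauer
relation `Θ = Σ_i H_i − Σ_j H_j'` for `G`, there is an isogeny `∏_j Jac_{X/H_j'} → ∏_i Jac_{X/H_i}`. **Example 1.4.**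
`S_3` has the Brauer relation `Θ = 2C_2 + C_3 − 2S_3 − {1}`. This is the unique `S_3`-Brauer relation, up to
multiplication by integers."; §2 p0008, **Definition 2.1** ("pseudo Brauer relation relative to `𝒱`":
`ρ_1 ⊕ ⊕_i ℂ[G/H_i] ≅ ρ_2 ⊕ ⊕_j ℂ[G/H_j']` with `⟨ρ_1, 𝒱⟩ = ⟨ρ_2, 𝒱⟩ = 0`) and Remark 2.2: "When `𝒱 = L[G]` is the regular
representation, Definition 2.1 coincides with the definition of a Brauer relation or a “relation between permutation
representations”"; §3 p0011: "This idea originates in work of Kani–Rosen [KR], though we follow more closely subsequent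
work of Chen, and de Smit and Edixhoven", **Lemma 3.6** (1): "`(π_H)_* ∘ (π_H)^* = |H|` and
`(π_H)^* ∘ (π_H)_* = Σ_{h ∈ H} h_*`", **Corollary 3.3**: "Let `Θ = Σ_i H_i − Σ_j H_j'` be a pseudo Brauer relation for
`X` […] Then `f_Φ : ∏_j Jac_{X/H_j'} → ∏_i Jac_{X/H_i}` is a `k`-isogeny."

D. Prasad, C. S. Rajan, *On an Archimedean analogue of Tate's conjecture*, J. Number Theory **99** (2003) 180–184
(arXiv math/0203295, fetched text `paper:arxiv-math_0203295`), p0003: "**Corollary 4.** Let `X` be a projective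
algebraic curve over a field `k` with an action of a finite group `G` on `X` over `k`. Let `H_1` and `H_2` be two
subgroups of `G` which intersect each conjugacy class in `G` in equal number of elements. Then the Jacobians of the
curves `X/H_1` and `X/H_2` are isogenous over `k`. *Proof.* It can be seen, cf. lemma below, that the Jacobian `J_i` of
`X/H_i` is isogenous to the connected component of the `H_i` fixed points of the Jacobian `J` of `X`. […] **Lemma 2.**
[…] the Jacobian of `X/H` is isogenous to the connected component of the `H` fixed points of the Jacobian `J` of `X`.";
p0002: "By Frobenius reciprocity, for any representation `V` of `G`, there is an isomorphism of `V^H` with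
`[V ⊗ k[G/H]]^G`", and Corollary 1 (Sunada's theorem): "Suppose that `G` is a finite group with subgroups `H_1` and
`H_2` such that each conjugacy class in `G` intersects `H_1` and `H_2` in equal number of elements."  C. Gordon,
E. Makover, B. Mützel, D. Webb, arXiv 1804.00031 (held `paper:arxiv-1804.00031`), p0003–p0004: "Two subgroups `Γ_1`
and `Γ_2` of a finite group `G` are said to be almost conjugate if every `G`-conjugacy class intersects `Γ_1` and `Γ_2`
in the same number of elements […] **Theorem 1.6.** (D. Prasad and C.S. Rajan) If two compact Riemann surfaces `M_1`
and `M_2` are Sunada isospectral, then their Jacobians are isogenous. […] As already observed by Gassmann, the character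
theory of representations of finite groups implies that `Γ_1` and `Γ_2` are representation equivalent in `G` if and
only if they satisfy the almost conjugacy condition".

E. Kani, M. Rosen, *Idempotent relations and factors of Jacobians*, Math. Ann. **284** (1989) 307–327, Theorem 3
(paywalled, acq-09882; statement as restated verbatim by Dokchitser–Green–Konstantinou–Morgan above); J. Paulhus,
Acta Arith. **132** (2008), §2 p. 232: "`ε_H = |H|⁻¹ Σ_{h ∈ H} h`", "we say that `ε_1 ∼ ε_2` if `χ(ε_1) = χ(ε_2)` for all
virtual `ℚ`-characters `χ` of `End⁰(J_X)`" (held `paper:doi-10-4064-aa132-3-3`).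

## Dictionary and what is proved (namespace `Literature.AlgebraicGeometry.Motives.AbelianVariety`)

A finite group `G` acts on the abelian variety `X` over the field `K` by `ρ : G →* End X`; subgroups come in two
families `H : ι → Subgroup G`, `H' : ι' → Subgroup G` with norm endomorphisms `End.of (N i) = Σ_{h ∈ H_i} ρ h`
(`= |H_i| ε_{H_i}`), `End.of N_G = Σ_g ρ g`; `B_H = Im N_H = ε_H(X)` (the tree's `image`; "the connected component of the
`H` fixed points of `J`", cf. Prasad–Rajan's Lemma 2 and DGKM's Lemma 3.6), `B_G = Im N_G`; `∼` is `IsIsogenous`, powers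
are constant biproducts `⨁ fun _ : Fin n ↦ −`.  The character of the permutation representation `ℚ[G/H]` at `g` is
`|{x ∈ G : x⁻¹ g x ∈ H}| / |H|` (the number of cosets fixed by `g`); we carry the integer **MARK**
`m_H(g) := |{x ∈ G : x⁻¹ g x ∈ H}|` (`= |C_G(g)| · |cl(g) ∩ H|`, §1 `card_conj_mem_eq_mul_card_isConj`).  A relation is
written with natural-number WEIGHTS `c₀` (copies of `X`, i.e. of `H = 1`), `c_G` (copies of `G`) and `c_i` on the left,
`d₀, d_G, d_j` on the right; a genuine Brauer relation `Σ_i H_i − Σ_j H'_j` is the case `c_i |H_i| = d_j |H'_j| = L`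
constant (then divide the exponents by `L`, `isIsogenous_of_classRelation_div`).

* §1 (group theory, any finite group) **`card_smul_sum_subgroup_eq_sum_card_conj_smul`** — for a CLASS FUNCTION `f`
  (`f(aga⁻¹) = f(g)`): `|G| · Σ_{h ∈ H} f(h) = Σ_{g ∈ G} m_H(g) · f(g)` (Frobenius reciprocity for `1_H^G` in counting
  form); **`card_conj_mem_eq_mul_card_isConj`** (`m_H(g) = |{x : x⁻¹gx = g}| · |{h ∈ H : h ∼ g}|` — marks versus
  "intersect each conjugacy class"); `card_conj_mem_bot` / `card_conj_mem_top` (`m_1(g) = |G|·[g = 1]`, `m_G(g) = |G|`).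
* §2 (any field) **`sum_mul_finrank_hom_image_eq_of_classRelation`**: if for every class function `f : G → ℤ`
  `c₀ f(1) + c_G Σ_g f(g) + Σ_i c_i Σ_{h ∈ H_i} f(h) = d₀ f(1) + d_G Σ_g f(g) + Σ_j d_j Σ_{h ∈ H'_j} f(h)`, then for every `B`
  `c₀ rk Hom(X, B) + c_G |G| rk Hom(B_G, B) + Σ_i c_i |H_i| rk Hom(B_{H_i}, B) = d₀ rk Hom(X, B) + d_G |G| rk Hom(B_G, B) +
  Σ_j d_j |H'_j| rk Hom(B_{H'_j}, B)` (evaluate at `f = χ_B ∘ ρ`); (perfect field) **`isIsogenous_of_classRelation`**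
  (`X^{c₀} × B_G^{c_G|G|} × ∏_i B_{H_i}^{c_i|H_i|} ∼ X^{d₀} × B_G^{d_G|G|} × ∏_j B_{H'_j}^{d_j|H'_j|}`) and
  **`isIsogenous_of_classRelation_div`** (all exponents divided by a common `L ≠ 0`).
* §3 **`classRelation_of_marks`**: the hypothesis of §2 follows from the per-element identity of marks
  `c₀ |G| [g = 1] + c_G |G| + Σ_i c_i m_{H_i}(g) = d₀ |G| [g = 1] + d_G |G| + Σ_j d_j m_{H'_j}(g)` for all `g` — i.e. from the
  equality of permutation characters (a Brauer relation, cleared of denominators); **`isIsogenous_of_brauerRelation`**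
  (KANI–ROSEN'S THEOREM 3: marks hypothesis ⟹ the isogeny of §2) and `isIsogenous_of_brauerRelation_div`.
* §4 **GASSMANN TRIPLES**: for subgroups `H₁, H₂` meeting every conjugacy class in the same number of elements
  (`|{h ∈ H₁ : h ∼ g}| = |{h ∈ H₂ : h ∼ g}|` for all `g`): `card_eq_of_gassmann` (`|H₁| = |H₂|`),
  **`finrank_hom_image_eq_of_gassmann`** (`rk Hom(B_{H₁}, B) = rk Hom(B_{H₂}, B)` for every `B`, any field),
  **`isIsogenous_of_gassmann`** (PRASAD–RAJAN: `B_{H₁} ∼ B_{H₂}`, perfect field), `dim_eq_of_gassmann`.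

Scope (stated, not hidden). (1) As in all predecessors `Jac_{X/H}` is REPLACED by `B_H = ε_H(X) = Im N_H` ("the
connected component of the `H` fixed points"); the explicit homomorphism `f_Φ` / "`x ↦ Σ Φ(g) g·x`" of the sources is
NOT constructed — the isogenies come from the Hom-count criterion (Poincaré reducibility over a perfect field), which is
why the isogeny statements assume `K` perfect (the sources: characteristic `0`, resp. any field for Prasad–Rajan);
the Hom-count identities hold over ANY field.  (2) The hypothesis is stated as an identity of class functions (§2) or
of marks / class counts (§§3–4) — the integral forms of "the permutation representations are isomorphic"; the
representation-theoretic equivalence of these forms with `⊕ ℚ[G/H_i] ≅ ⊕ ℚ[G/H'_j]` (character theory over `ℚ`) is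
not formalised here.  (3) DGKM's finer statements (duality `f_{φ^∨} = f_φ^∨`, functoriality, pseudo Brauer relations
relative to `V_ℓ`, regulator constants) are NOT formalised.  (4) No example is machine-checked in this file; the
relations of the sibling files (Theorem B for partitions, dihedral, Frobenius, …) are instances of §2 but are not
re-derived.

## References

* [KaniRosen1989] E. Kani, M. Rosen, *Idempotent relations and factors of Jacobians*, Math. Ann. 284 (1989) 307–327,
  Thm. 3 (Brauer relations), Thm. B.
* [DokchitserEtAl2022] V. Dokchitser, H. Green, A. Konstantinou, A. Morgan, *Parity of ranks of Jacobians of curves*,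
  Proc. London Math. Soc. (2025), arXiv:2211.06357, §1.3 Thm. 1.3 and Ex. 1.4, §2 Def. 2.1 and Rem. 2.2, §3 Thm. 3.2,
  Cor. 3.3, Lemma 3.6.
* [PrasadRajan2003] D. Prasad, C. S. Rajan, *On an Archimedean analogue of Tate's conjecture*, J. Number Theory 99
  (2003) 180–184, Cor. 1 (Sunada), Cor. 4, Lemma 2 (arXiv math/0203295, pp. 2–3).
* [GordonEtAl2018] C. Gordon, E. Makover, B. Mützel, D. Webb, *Transplantation and isogeny of intermediate Jacobians of
  compact Kähler manifolds*, arXiv:1804.00031, §1 (almost conjugate / representation equivalent subgroups; Thm. 1.6).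
* [Paulhus2008] J. Paulhus, Acta Arith. 132 (2008) 231–244, §2 (p. 232).
* [MumfordAV1970] D. Mumford, *Abelian Varieties* (1970), §19 Thm. 3.
-/

noncomputable section

universe u

open CategoryTheory CategoryTheory.Limits

namespace Literature.AlgebraicGeometry.Motives

namespace AbelianVariety

variable {K : Type u} [Field K]

/-! ## §1 Group theory: marks `m_H(g) = |{x : x⁻¹ g x ∈ H}|`, Frobenius reciprocity in counting form, class counts -/

section Marks

variable {G : Type} [Group G]

variable [Fintype G]

/-- **Frobenius reciprocity in counting form: `|G| · Σ_{h ∈ H} f(h) = Σ_{g ∈ G} |{x : x⁻¹gx ∈ H}| · f(g)` for a class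
function `f`** — both sides equal `Σ_{x ∈ G} Σ_{h ∈ H} f(x h x⁻¹)`; `|{x : x⁻¹ g x ∈ H}|/|H|` is the number of fixed points
of `g` on `G/H`, the character of `ℚ[G/H]` ("By Frobenius reciprocity, for any representation `V` of `G`, there is an
isomorphism of `V^H` with `[V ⊗ k[G/H]]^G`"). [cite: PrasadRajan2003, proof of Lemma 1 (arXiv p. 2)]
[cite: DokchitserEtAl2022, §1.3 (Brauer relations: "the associated permutation representations … are isomorphic")] -/
theorem card_smul_sum_subgroup_eq_sum_card_conj_smul {M : Type*} [AddCommMonoid M] (H : Subgroup G) [Fintype H]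
    (f : G → M) (hf : ∀ a g, f (a * g * a⁻¹) = f g) :
    Fintype.card G • ∑ h : H, f h = ∑ g, Nat.card {x : G // x⁻¹ * g * x ∈ H} • f g := by
  classical
  calc Fintype.card G • ∑ h : H, f h = ∑ _x : G, ∑ h : H, f h := by rw [Finset.sum_const, Finset.card_univ]
    _ = ∑ x : G, ∑ h : H, f (x * h * x⁻¹) :=
        Finset.sum_congr rfl fun x _ ↦ Finset.sum_congr rfl fun h _ ↦ (hf x h).symm
    _ = ∑ x : G, ∑ g : {g : G // x⁻¹ * g * x ∈ H}, f g := Finset.sum_congr rfl fun x _ ↦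
        -- conjugation by `x` identifies `H` with `{g : x⁻¹ g x ∈ H}`
        Fintype.sum_equiv
          (Equiv.subtypeEquiv (p := (· ∈ H)) (q := fun g : G ↦ x⁻¹ * g * x ∈ H) (MulAut.conj x).toEquiv
            fun a ↦ by
              rw [MulEquiv.toEquiv_eq_coe, MulEquiv.coe_toEquiv, MulAut.conj_apply,
                show x⁻¹ * (x * a * x⁻¹) * x = a by group])
          (fun h ↦ f (x * h * x⁻¹)) (fun g ↦ f g) fun _ ↦ rfl
    _ = ∑ x : G, ∑ g ∈ Finset.univ.filter (fun g : G ↦ x⁻¹ * g * x ∈ H), f g :=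
        Finset.sum_congr rfl fun x _ ↦ (Finset.sum_subtype _ (fun g ↦ by simp) f).symm
    _ = ∑ x : G, ∑ g, if x⁻¹ * g * x ∈ H then f g else 0 :=
        Finset.sum_congr rfl fun x _ ↦ Finset.sum_filter _ _
    _ = ∑ g, ∑ x : G, if x⁻¹ * g * x ∈ H then f g else 0 := Finset.sum_comm
    _ = ∑ g, Nat.card {x : G // x⁻¹ * g * x ∈ H} • f g := Finset.sum_congr rfl fun g _ ↦ by
        rw [← Finset.sum_filter, Finset.sum_const, Nat.card_eq_fintype_card, Fintype.card_subtype]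

/-- **Marks versus class counts: `|{x : x⁻¹ g x ∈ H}| = |{x : x⁻¹ g x = g}| · |{h ∈ H : h ∼ g}|`** — the conjugates
`x⁻¹ g x` with `x` running over `G` cover the class of `g`, each element `|C_G(g)|` times; so equality of marks for two
subgroups is the condition "intersect each conjugacy class in `G` in equal number of elements" (almost conjugate /
Gassmann equivalent subgroups). [cite: PrasadRajan2003, Cor. 1 and Cor. 4] [cite: GordonEtAl2018, §1 ("almost conjugate")] -/
theorem card_conj_mem_eq_mul_card_isConj (H : Subgroup G) (g : G) :
    Nat.card {x : G // x⁻¹ * g * x ∈ H} =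
      Nat.card {x : G // x⁻¹ * g * x = g} * Nat.card {h : H // IsConj g h} := by
  classical
  -- sort the `x` by the value `x⁻¹ g x ∈ H`
  have e1 : Nat.card {x : G // x⁻¹ * g * x ∈ H} = ∑ h : H, Nat.card {x : G // x⁻¹ * g * x = h} := by
    simp_rw [Nat.card_eq_fintype_card]
    let φ : {x : G // x⁻¹ * g * x ∈ H} → H := fun x ↦ ⟨x.1⁻¹ * g * x.1, x.2⟩
    rw [← Fintype.card_congr (Equiv.sigmaFiberEquiv φ), Fintype.card_sigma]
    refine Finset.sum_congr rfl fun h _ ↦ Fintype.card_congr ?_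
    exact ⟨fun y ↦ ⟨y.1.1, congrArg Subtype.val y.2⟩, fun x ↦ ⟨⟨x.1, by rw [x.2]; exact h.2⟩, Subtype.ext x.2⟩,
      fun _ ↦ rfl, fun _ ↦ rfl⟩
  -- each fibre is empty or in bijection with `{x : x⁻¹ g x = g}`
  have e2 : ∀ h : H, Nat.card {x : G // x⁻¹ * g * x = h} =
      if IsConj g (h : G) then Nat.card {x : G // x⁻¹ * g * x = g} else 0 := by
    intro h
    split_ifs with hc
    · obtain ⟨c, hc⟩ := isConj_iff.1 hc
      -- translate by `c`: `{x : x⁻¹ g x = h} ≃ {x : x⁻¹ g x = g}` (`c g c⁻¹ = h`)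
      refine Nat.card_congr (Equiv.subtypeEquiv (p := fun x : G ↦ x⁻¹ * g * x = h)
        (q := fun x : G ↦ x⁻¹ * g * x = g) (Equiv.mulRight c) fun x ↦ ?_)
      rw [Equiv.coe_mulRight, show (x * c)⁻¹ * g * (x * c) = c⁻¹ * (x⁻¹ * g * x) * c by group]
      constructor
      · intro hx; rw [hx, ← hc]; group
      · intro hx
        have : x⁻¹ * g * x = c * (c⁻¹ * (x⁻¹ * g * x) * c) * c⁻¹ := by group
        rw [this, hx, hc]
    · rw [Nat.card_eq_zero]
      left
      refine ⟨fun x ↦ hc (isConj_iff.2 ⟨x.1⁻¹, ?_⟩)⟩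
      rw [inv_inv]; exact x.2
  rw [e1, Finset.sum_congr rfl fun h _ ↦ e2 h, Finset.sum_ite, Finset.sum_const_zero, add_zero, Finset.sum_const,
    smul_eq_mul, mul_comm, Nat.card_eq_fintype_card (α := {h : H // IsConj g h}), Fintype.card_subtype]

/-- The marks of the trivial subgroup (the regular representation `ℚ[G/1]`, the term `{1}` of a Brauer relation):
`|{x : x⁻¹ g x = 1}| = |G|` if `g = 1`, and `0` otherwise. [cite: DokchitserEtAl2022, §1.3 Ex. 1.4 (the term {1} of Θ = 2C_2 + C_3 − 2S_3 − {1})] -/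
theorem card_conj_mem_bot [DecidableEq G] (g : G) :
    Nat.card {x : G // x⁻¹ * g * x ∈ (⊥ : Subgroup G)} = if g = 1 then Fintype.card G else 0 := by
  classical
  split_ifs with hg
  · subst hg
    rw [Nat.card_eq_fintype_card, Fintype.card_subtype, Finset.filter_true_of_mem fun x _ ↦ by simp,
      Finset.card_univ]
  · rw [Nat.card_eq_zero]
    left
    refine ⟨fun x ↦ hg ?_⟩
    have hx : x.1⁻¹ * g * x.1 = 1 := Subgroup.mem_bot.1 x.2
    have : g = x.1 * (x.1⁻¹ * g * x.1) * x.1⁻¹ := by group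
    rw [this, hx]; group

/-- The marks of the whole group (the trivial representation `ℚ[G/G]`, the term `G` of a Brauer relation):
`|{x : x⁻¹ g x ∈ G}| = |G|`. [cite: DokchitserEtAl2022, §1.3 Ex. 1.4 (the term S_3 of Θ = 2C_2 + C_3 − 2S_3 − {1})] -/
theorem card_conj_mem_top (g : G) : Nat.card {x : G // x⁻¹ * g * x ∈ (⊤ : Subgroup G)} = Fintype.card G := by
  classical
  rw [Nat.card_eq_fintype_card, Fintype.card_subtype, Finset.filter_true_of_mem fun x _ ↦ Subgroup.mem_top _,
    Finset.card_univ]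

end Marks

/-! ## §2 A relation of class functions gives the corresponding relation of Hom counts and the isogeny (any field,
resp. perfect field) -/

section ClassRelation

variable {X : AbelianVariety K} {G : Type} [Group G] [Fintype G] (ρ : G →* End X) {ι ι' : Type} [Fintype ι]
  [Fintype ι'] (H : ι → Subgroup G) (H' : ι' → Subgroup G) [∀ i, Fintype (H i)] [∀ j, Fintype (H' j)]
  {N : ι → (X ⟶ X)} {N' : ι' → (X ⟶ X)} {NG : X ⟶ X} (c₀ cG : ℕ) (c : ι → ℕ) (d₀ dG : ℕ) (d : ι' → ℕ)

/-- **A relation that holds for all class functions holds for the Hom counts** (any field).  If for every class function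
`f : G → ℤ` (`f(aga⁻¹) = f(g)`)
`c₀ f(1) + c_G Σ_g f(g) + Σ_i c_i Σ_{h ∈ H_i} f(h) = d₀ f(1) + d_G Σ_g f(g) + Σ_j d_j Σ_{h ∈ H'_j} f(h)` — i.e. the virtual
permutation character `c₀ |G|⁻¹… ` vanishes: `c₀·1_1^G/|G| + c_G 1_G^G + Σ_i (c_i|H_i|) 1_{H_i}^G/… `, a (pseudo) Brauer
relation cleared of denominators — then for every abelian variety `B`, evaluating at `f = χ_B ∘ ρ`
(`Σ_{h ∈ H} χ_B(ρ h) = |H| · rk Hom(B_H, B)`, `χ_B(1) = rk Hom(X, B)`):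
**`c₀ rk Hom(X, B) + c_G |G| rk Hom(B_G, B) + Σ_i c_i |H_i| rk Hom(B_{H_i}, B) =
d₀ rk Hom(X, B) + d_G |G| rk Hom(B_G, B) + Σ_j d_j |H'_j| rk Hom(B_{H'_j}, B)`**.
[cite: KaniRosen1989, Thm. 3] [cite: DokchitserEtAl2022, §1.3 Thm. 1.3, §2 Def. 2.1 and §3 Cor. 3.3]
[cite: Paulhus2008, §2 Definition ("ε_1 ∼ ε_2 if χ(ε_1) = χ(ε_2) for all virtual ℚ-characters", p. 232)] -/
theorem sum_mul_finrank_hom_image_eq_of_classRelation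
    (hrel : ∀ f : G → ℤ, (∀ a g, f (a * g * a⁻¹) = f g) →
      (c₀ : ℤ) * f 1 + cG * ∑ g, f g + ∑ i, (c i : ℤ) * ∑ h : H i, f h =
        d₀ * f 1 + dG * ∑ g, f g + ∑ j, (d j : ℤ) * ∑ h : H' j, f h)
    (hN : ∀ i, End.of (N i) = ∑ h : H i, ρ h) (hN' : ∀ j, End.of (N' j) = ∑ h : H' j, ρ h)
    (hNG : End.of NG = ∑ g, ρ g) (B : AbelianVariety K) :
    c₀ * Module.finrank ℤ (X ⟶ B) + cG * Fintype.card G * Module.finrank ℤ (image NG ⟶ B) +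
        ∑ i, c i * Fintype.card (H i) * Module.finrank ℤ (image (N i) ⟶ B) =
      d₀ * Module.finrank ℤ (X ⟶ B) + dG * Fintype.card G * Module.finrank ℤ (image NG ⟶ B) +
        ∑ j, d j * Fintype.card (H' j) * Module.finrank ℤ (image (N' j) ⟶ B) := by
  let t : G → ℤ := fun g ↦ LinearMap.trace ℤ (X ⟶ B) (Preadditive.leftComp B (End.asHom (ρ g))).toIntLinearMap
  have htd : ∀ g, t g = LinearMap.trace ℤ (X ⟶ B) (Preadditive.leftComp B (End.asHom (ρ g))).toIntLinearMap :=
    fun _ ↦ rfl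
  have ht : ∀ a g, t (a * g * a⁻¹) = t g := trace_leftComp_map_conj ρ B t htd
  have h1 : t 1 = Module.finrank ℤ (X ⟶ B) := trace_leftComp_map_one ρ B t htd
  have eG : (Fintype.card G : ℤ) * Module.finrank ℤ (image NG ⟶ B) = ∑ g, t g :=
    mul_finrank_hom_image_eq_sum ρ B t htd id hNG (normG_comp_normG_eq_card_nsmul ρ hNG)
  have eH : ∀ i, (Fintype.card (H i) : ℤ) * Module.finrank ℤ (image (N i) ⟶ B) = ∑ h : H i, t h := fun i ↦
    mul_finrank_hom_image_eq_sum ρ B t htd ((↑) : H i → G) (hN i) (norm_comp_norm_eq_card_nsmul ρ (hN i))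
  have eH' : ∀ j, (Fintype.card (H' j) : ℤ) * Module.finrank ℤ (image (N' j) ⟶ B) = ∑ h : H' j, t h := fun j ↦
    mul_finrank_hom_image_eq_sum ρ B t htd ((↑) : H' j → G) (hN' j) (norm_comp_norm_eq_card_nsmul ρ (hN' j))
  have key := hrel t ht
  rw [h1, ← eG] at key
  simp only [← eH, ← eH'] at key
  have key' : ((c₀ * Module.finrank ℤ (X ⟶ B) + cG * Fintype.card G * Module.finrank ℤ (image NG ⟶ B) +
      ∑ i, c i * Fintype.card (H i) * Module.finrank ℤ (image (N i) ⟶ B) : ℕ) : ℤ) =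
      ((d₀ * Module.finrank ℤ (X ⟶ B) + dG * Fintype.card G * Module.finrank ℤ (image NG ⟶ B) +
        ∑ j, d j * Fintype.card (H' j) * Module.finrank ℤ (image (N' j) ⟶ B) : ℕ) : ℤ) := by
    push_cast
    simp only [mul_assoc] at key ⊢
    exact key
  exact_mod_cast key'

variable [DecidableEq ι] [DecidableEq ι'] [PerfectField K]

/-- **The isogeny relation of a relation of class functions** (perfect field): under the hypothesis of
`sum_mul_finrank_hom_image_eq_of_classRelation`,
**`X^{c₀} × B_G^{c_G|G|} × ∏_i B_{H_i}^{c_i|H_i|} ∼ X^{d₀} × B_G^{d_G|G|} × ∏_j B_{H'_j}^{d_j|H'_j|}`** ("Each Brauer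
relation gives rise to an isogeny between Jacobians"). [cite: KaniRosen1989, Thm. 3] [cite: DokchitserEtAl2022, §1.3 Thm. 1.3 and §3 Cor. 3.3] -/
theorem isIsogenous_of_classRelation
    (hrel : ∀ f : G → ℤ, (∀ a g, f (a * g * a⁻¹) = f g) →
      (c₀ : ℤ) * f 1 + cG * ∑ g, f g + ∑ i, (c i : ℤ) * ∑ h : H i, f h =
        d₀ * f 1 + dG * ∑ g, f g + ∑ j, (d j : ℤ) * ∑ h : H' j, f h)
    (hN : ∀ i, End.of (N i) = ∑ h : H i, ρ h) (hN' : ∀ j, End.of (N' j) = ∑ h : H' j, ρ h)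
    (hNG : End.of NG = ∑ g, ρ g) :
    IsIsogenous
      ((⨁ fun _ : Fin c₀ ↦ X) ⊞ (⨁ fun _ : Fin (cG * Fintype.card G) ↦ image NG) ⊞
        ⨁ fun i ↦ ⨁ fun _ : Fin (c i * Fintype.card (H i)) ↦ image (N i))
      ((⨁ fun _ : Fin d₀ ↦ X) ⊞ (⨁ fun _ : Fin (dG * Fintype.card G) ↦ image NG) ⊞
        ⨁ fun j ↦ ⨁ fun _ : Fin (d j * Fintype.card (H' j)) ↦ image (N' j)) := by
  refine isIsogenous_iff_forall_finrank_hom_eq'.2 fun B ↦ ?_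
  simp only [finrank_hom_biprod, finrank_hom_biproduct, Finset.sum_const, Finset.card_univ, Fintype.card_fin,
    smul_eq_mul]
  have key := sum_mul_finrank_hom_image_eq_of_classRelation ρ H H' c₀ cG c d₀ dG d hrel hN hN' hNG B
  simp only [mul_assoc, add_assoc] at key ⊢
  exact key

/-- **The divided isogeny relation**: if moreover a common `L ≠ 0` divides all exponents — `L e₀ = c₀`, `L e_G = c_G|G|`,
`L e_i = c_i |H_i|` and likewise on the right — then `X^{e₀} × B_G^{e_G} × ∏_i B_{H_i}^{e_i} ∼ X^{e₀'} × B_G^{e_G'} ×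
∏_j B_{H'_j}^{e_j'}` (for a Brauer relation `Σ_i H_i − Σ_j H'_j` proper: `c_i = L/|H_i|`, all `e_i = 1`, and one obtains
"`∏_j Jac_{X/H_j'} → ∏_i Jac_{X/H_i}`" up to isogeny). [cite: KaniRosen1989, Thm. 3]
[cite: DokchitserEtAl2022, §1.3 Thm. 1.3 and Ex. 1.4 ("Θ = 2C_2 + C_3 − 2S_3 − {1}")] -/
theorem isIsogenous_of_classRelation_div
    (hrel : ∀ f : G → ℤ, (∀ a g, f (a * g * a⁻¹) = f g) →
      (c₀ : ℤ) * f 1 + cG * ∑ g, f g + ∑ i, (c i : ℤ) * ∑ h : H i, f h =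
        d₀ * f 1 + dG * ∑ g, f g + ∑ j, (d j : ℤ) * ∑ h : H' j, f h)
    (hN : ∀ i, End.of (N i) = ∑ h : H i, ρ h) (hN' : ∀ j, End.of (N' j) = ∑ h : H' j, ρ h)
    (hNG : End.of NG = ∑ g, ρ g) {L e₀ eG e₀' eG' : ℕ} {e : ι → ℕ} {e' : ι' → ℕ} (hL : L ≠ 0)
    (he₀ : L * e₀ = c₀) (heG : L * eG = cG * Fintype.card G) (he : ∀ i, L * e i = c i * Fintype.card (H i))
    (he₀' : L * e₀' = d₀) (heG' : L * eG' = dG * Fintype.card G) (he' : ∀ j, L * e' j = d j * Fintype.card (H' j)) :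
    IsIsogenous
      ((⨁ fun _ : Fin e₀ ↦ X) ⊞ (⨁ fun _ : Fin eG ↦ image NG) ⊞ ⨁ fun i ↦ ⨁ fun _ : Fin (e i) ↦ image (N i))
      ((⨁ fun _ : Fin e₀' ↦ X) ⊞ (⨁ fun _ : Fin eG' ↦ image NG) ⊞ ⨁ fun j ↦ ⨁ fun _ : Fin (e' j) ↦ image (N' j)) := by
  refine isIsogenous_iff_forall_finrank_hom_eq'.2 fun B ↦ ?_
  simp only [finrank_hom_biprod, finrank_hom_biproduct, Finset.sum_const, Finset.card_univ, Fintype.card_fin,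
    smul_eq_mul]
  have key := sum_mul_finrank_hom_image_eq_of_classRelation ρ H H' c₀ cG c d₀ dG d hrel hN hN' hNG B
  have hl : ∀ i, c i * Fintype.card (H i) * Module.finrank ℤ (image (N i) ⟶ B) =
      L * (e i * Module.finrank ℤ (image (N i) ⟶ B)) := fun i ↦ by rw [← mul_assoc, he i]
  have hr : ∀ j, d j * Fintype.card (H' j) * Module.finrank ℤ (image (N' j) ⟶ B) =
      L * (e' j * Module.finrank ℤ (image (N' j) ⟶ B)) := fun j ↦ by rw [← mul_assoc, he' j]
  simp only [hl, hr, ← he₀, ← heG, ← he₀', ← heG', ← Finset.mul_sum] at key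
  refine Nat.eq_of_mul_eq_mul_left (Nat.pos_of_ne_zero hL) ?_
  simp only [mul_add, ← mul_assoc]
  simpa only [← mul_assoc, add_assoc] using key

end ClassRelation

/-! ## §3 Brauer relations (equality of permutation characters, as marks) give the class-function relation -/

section BrauerRelation

variable {X : AbelianVariety K} {G : Type} [Group G] [Fintype G] [DecidableEq G] (ρ : G →* End X) {ι ι' : Type}
  [Fintype ι]
  [Fintype ι'] (H : ι → Subgroup G) (H' : ι' → Subgroup G) [∀ i, Fintype (H i)] [∀ j, Fintype (H' j)]
  {N : ι → (X ⟶ X)} {N' : ι' → (X ⟶ X)} {NG : X ⟶ X} (c₀ cG : ℕ) (c : ι → ℕ) (d₀ dG : ℕ) (d : ι' → ℕ)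

omit [∀ i, Fintype (H i)] [∀ j, Fintype (H' j)] in
/-- **A Brauer relation, as an identity of marks, gives the relation for all class functions.**  If for every `g ∈ G`
`c₀ |G| [g = 1] + c_G |G| + Σ_i c_i m_{H_i}(g) = d₀ |G| [g = 1] + d_G |G| + Σ_j d_j m_{H'_j}(g)`, `m_H(g) = |{x : x⁻¹gx ∈ H}|`
(`= |H| ·` the number of fixed points of `g` on `G/H`: the permutation characters, weighted and cleared of denominators,
agree — "the associated permutation representations `⊕_i ℂ[G/H_i]` and `⊕_j ℂ[G/H_j']` are isomorphic"), then
`c₀ f(1) + c_G Σ f + Σ_i c_i Σ_{H_i} f = d₀ f(1) + d_G Σ f + Σ_j d_j Σ_{H'_j} f` for every class function `f`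
(by `|G| · Σ_{h ∈ H} f(h) = Σ_g m_H(g) f(g)`, then cancel `|G|`). [cite: DokchitserEtAl2022, §1.3 and §2 Def. 2.1, Rem. 2.2]
[cite: KaniRosen1989, Thm. 3] [cite: PrasadRajan2003, proof of Lemma 1] -/
theorem classRelation_of_marks [∀ i, Fintype (H i)] [∀ j, Fintype (H' j)]
    (hmarks : ∀ g : G, c₀ * (if g = 1 then Fintype.card G else 0) + cG * Fintype.card G +
        ∑ i, c i * Nat.card {x : G // x⁻¹ * g * x ∈ H i} =
      d₀ * (if g = 1 then Fintype.card G else 0) + dG * Fintype.card G +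
        ∑ j, d j * Nat.card {x : G // x⁻¹ * g * x ∈ H' j})
    (f : G → ℤ) (hf : ∀ a g, f (a * g * a⁻¹) = f g) :
    (c₀ : ℤ) * f 1 + cG * ∑ g, f g + ∑ i, (c i : ℤ) * ∑ h : H i, f h =
      d₀ * f 1 + dG * ∑ g, f g + ∑ j, (d j : ℤ) * ∑ h : H' j, f h := by
  classical
  have hG0 : (Fintype.card G : ℤ) ≠ 0 := by exact_mod_cast Fintype.card_ne_zero
  -- the marks, as integers
  let m : Subgroup G → G → ℤ := fun S g ↦ (Nat.card {x : G // x⁻¹ * g * x ∈ S} : ℤ)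
  let δ : G → ℤ := fun g ↦ ((if g = 1 then Fintype.card G else 0 : ℕ) : ℤ)
  have key : ∀ g : G, (c₀ : ℤ) * δ g + cG * Fintype.card G + ∑ i, (c i : ℤ) * m (H i) g =
      d₀ * δ g + dG * Fintype.card G + ∑ j, (d j : ℤ) * m (H' j) g := fun g ↦ by
    have h := hmarks g
    simp only [m, δ]
    exact_mod_cast h
  -- every term, multiplied by `|G|`, is a sum `Σ_g (coefficient g) · f g`
  have hH : ∀ (S : Subgroup G) [Fintype S], (Fintype.card G : ℤ) * ∑ h : S, f h = ∑ g, m S g * f g := by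
    intro S _
    have h := card_smul_sum_subgroup_eq_sum_card_conj_smul S f hf
    simp only [nsmul_eq_mul] at h
    exact h
  have h1 : (Fintype.card G : ℤ) * f 1 = ∑ g, δ g * f g := by
    rw [Finset.sum_eq_single (1 : G) (fun g _ hg ↦ by simp only [δ, if_neg hg, Nat.cast_zero, zero_mul])
      (fun h ↦ (h (Finset.mem_univ _)).elim)]
    simp [δ]
  have hGs : (Fintype.card G : ℤ) * ∑ g, f g = ∑ g, (Fintype.card G : ℤ) * f g := Finset.mul_sum _ _ _
  have hfam : ∀ {κ : Type} [Fintype κ] (S : κ → Subgroup G) [∀ k, Fintype (S k)] (w : κ → ℕ),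
      (Fintype.card G : ℤ) * ∑ k, (w k : ℤ) * ∑ h : S k, f h = ∑ g, (∑ k, (w k : ℤ) * m (S k) g) * f g := by
    intro κ _ S _ w
    rw [Finset.mul_sum, Finset.sum_congr rfl fun k _ ↦ by rw [mul_left_comm, hH (S k), Finset.mul_sum],
      Finset.sum_comm]
    refine Finset.sum_congr rfl fun g _ ↦ ?_
    rw [Finset.sum_mul]
    exact Finset.sum_congr rfl fun k _ ↦ by ring
  have expand : ∀ (a₀ aG : ℕ) {κ : Type} [Fintype κ] (S : κ → Subgroup G) [∀ k, Fintype (S k)] (w : κ → ℕ),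
      (Fintype.card G : ℤ) * ((a₀ : ℤ) * f 1 + aG * ∑ g, f g + ∑ k, (w k : ℤ) * ∑ h : S k, f h) =
        ∑ g, ((a₀ : ℤ) * δ g + aG * Fintype.card G + ∑ k, (w k : ℤ) * m (S k) g) * f g := by
    intro a₀ aG κ _ S _ w
    rw [mul_add, mul_add, mul_left_comm, h1, mul_left_comm, hGs, hfam S w, Finset.mul_sum, Finset.mul_sum,
      ← Finset.sum_add_distrib, ← Finset.sum_add_distrib]
    exact Finset.sum_congr rfl fun g _ ↦ by ring
  refine mul_left_cancel₀ hG0 ?_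
  rw [expand c₀ cG H c, expand d₀ dG H' d]
  exact Finset.sum_congr rfl fun g _ ↦ by rw [key g]

variable [DecidableEq ι] [DecidableEq ι'] [PerfectField K]

/-- **Kani–Rosen's Theorem 3: a Brauer relation gives an isogeny relation** (for an abelian variety with a `G`-action
over a perfect field).  If the marks satisfy, for every `g ∈ G`,
`c₀ |G| [g = 1] + c_G |G| + Σ_i c_i |{x : x⁻¹gx ∈ H_i}| = d₀ |G| [g = 1] + d_G |G| + Σ_j d_j |{x : x⁻¹gx ∈ H'_j}|` (the
weighted permutation characters `c₀|G|·1_1^G/|G|…` agree — for `c_i |H_i| = d_j |H'_j| = L` exactly the Brauer relation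
`Σ_i H_i − Σ_j H'_j`: "`⊕_i ℂ[G/H_i]` and `⊕_j ℂ[G/H_j']` are isomorphic"), then
**`X^{c₀} × B_G^{c_G|G|} × ∏_i B_{H_i}^{c_i|H_i|} ∼ X^{d₀} × B_G^{d_G|G|} × ∏_j B_{H'_j}^{d_j|H'_j|}`** ("For every Brauer
relation `Θ = Σ_i H_i − Σ_j H_j'` for `G`, there is an isogeny `∏_j Jac_{X/H_j'} → ∏_i Jac_{X/H_i}`").
[cite: KaniRosen1989, Thm. 3] [cite: DokchitserEtAl2022, §1.3 Thm. 1.3 and §3 Cor. 3.3] -/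
theorem isIsogenous_of_brauerRelation
    (hmarks : ∀ g : G, c₀ * (if g = 1 then Fintype.card G else 0) + cG * Fintype.card G +
        ∑ i, c i * Nat.card {x : G // x⁻¹ * g * x ∈ H i} =
      d₀ * (if g = 1 then Fintype.card G else 0) + dG * Fintype.card G +
        ∑ j, d j * Nat.card {x : G // x⁻¹ * g * x ∈ H' j})
    (hN : ∀ i, End.of (N i) = ∑ h : H i, ρ h) (hN' : ∀ j, End.of (N' j) = ∑ h : H' j, ρ h)
    (hNG : End.of NG = ∑ g, ρ g) :
    IsIsogenous
      ((⨁ fun _ : Fin c₀ ↦ X) ⊞ (⨁ fun _ : Fin (cG * Fintype.card G) ↦ image NG) ⊞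
        ⨁ fun i ↦ ⨁ fun _ : Fin (c i * Fintype.card (H i)) ↦ image (N i))
      ((⨁ fun _ : Fin d₀ ↦ X) ⊞ (⨁ fun _ : Fin (dG * Fintype.card G) ↦ image NG) ⊞
        ⨁ fun j ↦ ⨁ fun _ : Fin (d j * Fintype.card (H' j)) ↦ image (N' j)) :=
  isIsogenous_of_classRelation ρ H H' c₀ cG c d₀ dG d (classRelation_of_marks H H' c₀ cG c d₀ dG d hmarks) hN hN' hNG

/-- **Kani–Rosen's Theorem 3, exponents divided by a common `L ≠ 0`** (`L e₀ = c₀`, `L e_G = c_G |G|`,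
`L e_i = c_i |H_i|`, and likewise on the right): `X^{e₀} × B_G^{e_G} × ∏_i B_{H_i}^{e_i} ∼ X^{e₀'} × B_G^{e_G'} ×
∏_j B_{H'_j}^{e_j'}` — for `S_3`'s relation `2C_2 + C_3 − 2S_3 − {1}` (`L = 6`): `B_{C_2}² × B_{C_3} ∼ B_{S_3}² × X`,
"`Jac_B → E × E × Jac_D`". [cite: KaniRosen1989, Thm. 3] [cite: DokchitserEtAl2022, §1.3 Thm. 1.3 and Ex. 1.4] -/
theorem isIsogenous_of_brauerRelation_div
    (hmarks : ∀ g : G, c₀ * (if g = 1 then Fintype.card G else 0) + cG * Fintype.card G +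
        ∑ i, c i * Nat.card {x : G // x⁻¹ * g * x ∈ H i} =
      d₀ * (if g = 1 then Fintype.card G else 0) + dG * Fintype.card G +
        ∑ j, d j * Nat.card {x : G // x⁻¹ * g * x ∈ H' j})
    (hN : ∀ i, End.of (N i) = ∑ h : H i, ρ h) (hN' : ∀ j, End.of (N' j) = ∑ h : H' j, ρ h)
    (hNG : End.of NG = ∑ g, ρ g) {L e₀ eG e₀' eG' : ℕ} {e : ι → ℕ} {e' : ι' → ℕ} (hL : L ≠ 0)
    (he₀ : L * e₀ = c₀) (heG : L * eG = cG * Fintype.card G) (he : ∀ i, L * e i = c i * Fintype.card (H i))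
    (he₀' : L * e₀' = d₀) (heG' : L * eG' = dG * Fintype.card G) (he' : ∀ j, L * e' j = d j * Fintype.card (H' j)) :
    IsIsogenous
      ((⨁ fun _ : Fin e₀ ↦ X) ⊞ (⨁ fun _ : Fin eG ↦ image NG) ⊞ ⨁ fun i ↦ ⨁ fun _ : Fin (e i) ↦ image (N i))
      ((⨁ fun _ : Fin e₀' ↦ X) ⊞ (⨁ fun _ : Fin eG' ↦ image NG) ⊞ ⨁ fun j ↦ ⨁ fun _ : Fin (e' j) ↦ image (N' j)) :=
  isIsogenous_of_classRelation_div ρ H H' c₀ cG c d₀ dG d (classRelation_of_marks H H' c₀ cG c d₀ dG d hmarks)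
    hN hN' hNG hL he₀ heG he he₀' heG' he'

end BrauerRelation

/-! ## §4 Gassmann equivalent (almost conjugate) subgroups have isogenous images: `B_{H₁} ∼ B_{H₂}` -/

section Gassmann

variable {X : AbelianVariety K} {G : Type} [Group G] [Fintype G] (ρ : G →* End X) (H₁ H₂ : Subgroup G)
  [Fintype H₁] [Fintype H₂] {N₁ N₂ : X ⟶ X}

omit [Fintype H₁] [Fintype H₂] in
/-- Gassmann equivalent subgroups have equal marks: `|{x : x⁻¹gx ∈ H₁}| = |{x : x⁻¹gx ∈ H₂}|` for every `g` ("`Γ_1`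
and `Γ_2` are representation equivalent in `G` if and only if they satisfy the almost conjugacy condition").
[cite: GordonEtAl2018, §1.2] [cite: PrasadRajan2003, Cor. 1 and Cor. 4] -/
theorem card_conj_mem_eq_of_gassmann
    (hG : ∀ g : G, Nat.card {h : H₁ // IsConj g h} = Nat.card {h : H₂ // IsConj g h}) (g : G) :
    Nat.card {x : G // x⁻¹ * g * x ∈ H₁} = Nat.card {x : G // x⁻¹ * g * x ∈ H₂} := by
  rw [card_conj_mem_eq_mul_card_isConj, card_conj_mem_eq_mul_card_isConj, hG g]

/-- For a class function `f`, Gassmann equivalent subgroups give equal sums: `|G| · Σ_{h ∈ H₁} f(h) = |G| · Σ_{h ∈ H₂} f(h)`.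
[cite: PrasadRajan2003, Lemma 1 and Cor. 1] [cite: GordonEtAl2018, §1.2] -/
theorem card_mul_sum_eq_of_gassmann
    (hG : ∀ g : G, Nat.card {h : H₁ // IsConj g h} = Nat.card {h : H₂ // IsConj g h}) (f : G → ℤ)
    (hf : ∀ a g, f (a * g * a⁻¹) = f g) :
    (Fintype.card G : ℤ) * ∑ h : H₁, f h = (Fintype.card G : ℤ) * ∑ h : H₂, f h := by
  have h₁ := card_smul_sum_subgroup_eq_sum_card_conj_smul H₁ f hf
  have h₂ := card_smul_sum_subgroup_eq_sum_card_conj_smul H₂ f hf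
  simp only [nsmul_eq_mul] at h₁ h₂
  rw [h₁, h₂]
  exact Finset.sum_congr rfl fun g _ ↦ by rw [card_conj_mem_eq_of_gassmann H₁ H₂ hG g]

/-- **Gassmann equivalent subgroups have the same order** (`f = 1` above: `|G||H₁| = |G||H₂|`).
[cite: PrasadRajan2003, Cor. 1] [cite: GordonEtAl2018, §1 ("there is a set bijection Γ_1 → Γ_2")] -/
theorem card_eq_of_gassmann (hG : ∀ g : G, Nat.card {h : H₁ // IsConj g h} = Nat.card {h : H₂ // IsConj g h}) :
    Fintype.card H₁ = Fintype.card H₂ := by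
  have h := card_mul_sum_eq_of_gassmann H₁ H₂ hG (fun _ ↦ 1) fun _ _ ↦ rfl
  simp only [Finset.sum_const, Finset.card_univ, nsmul_eq_mul, mul_one] at h
  have hG0 : (Fintype.card G : ℤ) ≠ 0 := by exact_mod_cast Fintype.card_ne_zero
  exact_mod_cast mul_left_cancel₀ hG0 h

/-- **Gassmann equivalent subgroups have the same Hom counts** (any field): if `H₁`, `H₂ ≤ G` meet every conjugacy
class of `G` in the same number of elements, then `rk Hom(B_{H₁}, B) = rk Hom(B_{H₂}, B)` for every abelian variety `B`
(`|H| rk Hom(B_H, B) = Σ_{h ∈ H} χ_B(ρ h)` depends only on the class counts of `H`; for `V = Hom⁰(X, B)`: "an isomorphism of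
`V^{H_1}` with `V^{H_2}`"). [cite: PrasadRajan2003, Lemma 1, Cor. 4 and Lemma 2] [cite: KaniRosen1989, Thm. 3] -/
theorem finrank_hom_image_eq_of_gassmann
    (hG : ∀ g : G, Nat.card {h : H₁ // IsConj g h} = Nat.card {h : H₂ // IsConj g h})
    (hN₁ : End.of N₁ = ∑ h : H₁, ρ h) (hN₂ : End.of N₂ = ∑ h : H₂, ρ h) (B : AbelianVariety K) :
    Module.finrank ℤ (image N₁ ⟶ B) = Module.finrank ℤ (image N₂ ⟶ B) := by
  let t : G → ℤ := fun g ↦ LinearMap.trace ℤ (X ⟶ B) (Preadditive.leftComp B (End.asHom (ρ g))).toIntLinearMap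
  have htd : ∀ g, t g = LinearMap.trace ℤ (X ⟶ B) (Preadditive.leftComp B (End.asHom (ρ g))).toIntLinearMap :=
    fun _ ↦ rfl
  have ht : ∀ a g, t (a * g * a⁻¹) = t g := trace_leftComp_map_conj ρ B t htd
  have e₁ : (Fintype.card H₁ : ℤ) * Module.finrank ℤ (image N₁ ⟶ B) = ∑ h : H₁, t h :=
    mul_finrank_hom_image_eq_sum ρ B t htd ((↑) : H₁ → G) hN₁ (norm_comp_norm_eq_card_nsmul ρ hN₁)
  have e₂ : (Fintype.card H₂ : ℤ) * Module.finrank ℤ (image N₂ ⟶ B) = ∑ h : H₂, t h :=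
    mul_finrank_hom_image_eq_sum ρ B t htd ((↑) : H₂ → G) hN₂ (norm_comp_norm_eq_card_nsmul ρ hN₂)
  have h := card_mul_sum_eq_of_gassmann H₁ H₂ hG t ht
  rw [← e₁, ← e₂, card_eq_of_gassmann H₁ H₂ hG] at h
  have h0 : (Fintype.card G : ℤ) * Fintype.card H₂ ≠ 0 :=
    mul_ne_zero (by exact_mod_cast Fintype.card_ne_zero) (by exact_mod_cast Fintype.card_ne_zero)
  have h' : (Fintype.card G : ℤ) * Fintype.card H₂ * Module.finrank ℤ (image N₁ ⟶ B) =
      (Fintype.card G : ℤ) * Fintype.card H₂ * Module.finrank ℤ (image N₂ ⟶ B) := by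
    simpa only [mul_assoc] using h
  exact_mod_cast mul_left_cancel₀ h0 h'

variable [PerfectField K]

/-- **Prasad–Rajan (Sunada's construction for Jacobians): Gassmann equivalent subgroups have isogenous images,
`B_{H₁} ∼ B_{H₂}`** — for an abelian variety `X` over a perfect field with an action of `G` and subgroups `H₁`, `H₂`
"which intersect each conjugacy class in `G` in equal number of elements" ("Then the Jacobians of the curves `X/H_1` and
`X/H_2` are isogenous"; `Jac(X/H)` "is isogenous to the connected component of the `H` fixed points of the Jacobian",
here `B_H = Im N_H`). [cite: PrasadRajan2003, Cor. 4 and Lemma 2] [cite: GordonEtAl2018, §1 Thm. 1.6] [cite: KaniRosen1989, Thm. 3] -/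
theorem isIsogenous_of_gassmann
    (hG : ∀ g : G, Nat.card {h : H₁ // IsConj g h} = Nat.card {h : H₂ // IsConj g h})
    (hN₁ : End.of N₁ = ∑ h : H₁, ρ h) (hN₂ : End.of N₂ = ∑ h : H₂, ρ h) : IsIsogenous (image N₁) (image N₂) :=
  isIsogenous_iff_forall_finrank_hom_eq'.2 fun B ↦ finrank_hom_image_eq_of_gassmann ρ H₁ H₂ hG hN₁ hN₂ B

/-- **Dimensions: `dim B_{H₁} = dim B_{H₂}`** for Gassmann equivalent `H₁`, `H₂` (perfect field; for Jacobians
`g(X/H_1) = g(X/H_2)`). [cite: PrasadRajan2003, Cor. 4] [cite: GordonEtAl2018, §1 Thm. 1.6] -/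
theorem dim_eq_of_gassmann
    (hG : ∀ g : G, Nat.card {h : H₁ // IsConj g h} = Nat.card {h : H₂ // IsConj g h})
    (hN₁ : End.of N₁ = ∑ h : H₁, ρ h) (hN₂ : End.of N₂ = ∑ h : H₂, ρ h) : (image N₁).dim = (image N₂).dim :=
  (isIsogenous_of_gassmann ρ H₁ H₂ hG hN₁ hN₂).dim_eq

end Gassmann

end AbelianVariety

end Literature.AlgebraicGeometry.Motives
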